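import Summits.ResolutionOfSingularities.ResolutionOfSingularities.Theorems.HilbertSamuelEliminationSigmaMaxModificationsCorridor3WLadderHybridLowSwallow
import Summits.ResolutionOfSingularities.ResolutionOfSingularities.Theorems.HilbertSamuelEliminationSigmaMaxModificationsCorridor3WLadderStrataCurve
import Summits.ResolutionOfSingularities.ResolutionOfSingularities.Theorems.HilbertSamuelEliminationSigmaMaxModificationsCorridor3WLadderStrataNearFibre
import Summits.ResolutionOfSingularities.ResolutionOfSingularities.Theorems.HilbertSamuelEliminationSigmaMaxModificationsCorridor3WLadderStrataCentreDispatch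
import Summits.ResolutionOfSingularities.ResolutionOfSingularities.Theorems.HilbertSamuelEliminationSigmaMaxModificationsCorridor3WLadderGradeZero
import HarnessLib

/-!
# [OURS · L1 W4.2] `Corridor3WLadderHybridLowBirths` — THE (b) SUPPLIER AT W-LOW: for ANY boundary-reading strategy with permissible in-stratum steps on
# good stages, along a never-isolated `ē ≤ 2` chain, (c-swallow) ⇒ (b) «components through `x_{n+1}` dominate components through `x_n`», modulo
# CJS Thm. 3.14 (numerical form and near-fibre form F-61) under `CharHypothesis` — so (b) is NOT an independent Low residual

Crux chain w42 (`SigmaMaxModifications`, stmt-ResolutionOfSingularities-18506; conjunct `SigmaMaxModificationsCorridor3`,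
stmt-ResolutionOfSingularities-19249), CHAIN v3.20 §0s.4 «040: HybridLow follow-ups»; memo `LOW-SUPPLIERS-memo.md` (47a2e00fad984739) §2 (b). Typer
res-type-040 (gen 19). Port of res-L1-w42-stub-4's CJS rows (b-fib)/(b-curve) ⇒ (b-end) (`…WLadderStrataFibre` `strataCycleEndBirthsSettle_of_fibre_of_curve`,
`…WLadderStrataNearFibre` `strataNearFibreSubsingleton_of_thm314_nearFibre`, `…WLadderStrataCurve` `strataCentreCurveAt_of_thm_3_14`), where the CJS input
«the END centre is the label part, whose components are stratum components» is REPLACED by (c-swallow) «the centre contains a stratum component through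
`x_n`» + «components of a REGULAR closed subscheme through one point coincide» (stub-4's `eq_of_mem_componentsIn_of_isRegular`). OURS (cell res-hironaka,
slot W4.2); NOT statements of H. Hironaka's manuscript [Hironaka2017] nor of [CossartJannsenSaito2020]; AI-drafted, weaker than expert review. Sorry-free
PROOF file: no definition, no named fact beyond the two printed Thm. 3.14 renderings taken as hypotheses. Helper file `--supports stmt-ResolutionOfSingularities-19249`
(counted 0).

THE STEP LAW (`StepProjectionσE.closure_image_mem_componentsIn_of_swallow`). A step `f : X' = Bl_C X ⟶ X` of the chain with permissible `C ⊆ X(ν)`, chain point `x`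
never isolated with `ē_x ≤ 2` and `CharHypothesis X x`, next point `x'` near and never isolated, and a newborn component `Z' ∋ x'` of `X'(ν)` dominating NO
component of `X(ν)`: births lie over the centre (`subset_preimage_support_of_not_mem_componentsIn`), so `x ∈ V(C)`; by (c-swallow) `V(C) ⊇ Z ∋ x` for a
stratum component `Z`, positive-dimensional (`nontrivial_of_mem_componentsThrough_of_not_iso`), so `dim 𝒪_{V(C),x} ≥ 1` and `e_x ≤ ē_x ≤ 2 ≤ dim + 1`:
F-61 makes the near fibre over `x` a subsingleton, Thm. 3.14 gives `dim 𝒪_{V(C),x} < e_x ≤ 2`. The generic point `ζ` of `Z'`: if `f ζ = x` then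
`Z' = {x'}` — impossible at a never-isolated `x'`; else `A = closure {f ζ} ⊆ V(C)` is irreducible through `x`, `≠ {x}`, hence a COMPONENT of `V(C)`
(`two_le_ringKrullDim_quotient_stalkIdeal`), hence `= Z` (regular `V(C)`: components through `x` coincide), a stratum component dominated by `Z'` —
contradiction. No functionality, no labels, no cycles.

Contents (namespace `…Theorems.SigmaMaxModificationsCorridor3.Sigma`): `StepProjectionσE.closure_image_mem_componentsIn_of_swallow` (one step),
`strataBirthsSettleFromσE_of_swallow` ((c-swallow)From ⇒ (b)From on the From-`s₀` scope, grade `G ⊆ (ē ≤ 2)`, `CharHypothesis` along the reach),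
`charHypothesis_of_reachesσE` ((F1) regime `3 ≤ p` along runs over a field of characteristic `p`, dimension `≤ 3`, via res-type-012's `dim_le_of_reachesσE`), and the origin-level
`strataBirthsSettleFromσE_init_of_swallow` / hybrid form `low_init_hybrid_of_rows_of_swallow` ((b) removed from the residual list: Low ⟸ (c-rep) ∧ (c-menu) ∧ units
in the regime `3 ≤ p`). References: CJS LNM 2270 Thm. 3.14, Def. 3.1, Rem. 6.29 (1), p. 92 [CossartJannsenSaito2020]; Stacks 01J7; tree p505133/p515327/…
(stub-4), p535770, p534481, p532417.
-/

noncomputable section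

set_option linter.dupNamespace false

open CategoryTheory CategoryTheory.Limits AlgebraicGeometry TopologicalSpace Topology IsLocalRing
open Summit.ResolutionOfSingularities.ResolutionOfSingularities.Theorems.CampaignW42
open Literature.AlgebraicGeometry.Resolution Literature.RingTheory.HilbertSamuel
open Literature.AlgebraicGeometry.CossartJannsenSaito2020
open Summit.ResolutionOfSingularities.ResolutionOfSingularities.Theorems.SigmaMaxModificationsCorridor3
open Summit.ResolutionOfSingularities.ResolutionOfSingularities.Theorems.SigmaMaxModificationsCorridor3.Moving

namespace Summit.ResolutionOfSingularities.ResolutionOfSingularities.Theorems.SigmaMaxModificationsCorridor3.Sigma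

universe u

variable {N : ℕ} {ν : ℕ → ℕ} {k : Type u} [Field k] {σ : StrategyE.{u}}

/-! ## §1. The one-step law -/

/-- **ONE STEP: at a W-low never-isolated chain point whose blow-up swallows a stratum component, every stratum component through the next chain point
DOMINATES a stratum component** (module docstring; CJS Thm. 3.14 numerical + near-fibre forms under `CharHypothesis`). [cite: CossartJannsenSaito2020, Thm. 3.14, Def. 3.1] -/
theorem StepProjectionσE.closure_image_mem_componentsIn_of_swallow (h314 : CossartJannsenSaito2020_thm_3_14.{u})
    (h314f : Thm314_nearFibre_subsingleton.{u}) {s s' : MarkedStageE.{u}} {f : s'.W ⟶ s.W} (hf : StepProjectionσE σ N ν s s' f)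
    (hgood : RunGood k N ν s.W) (hgood' : RunGood k N ν s'.W)
    (hadm : ∀ (C : s.W.IdealSheafData) (P' : Option (Pending (blowup C))), σ.step s.W s.ln N ν s.L s.P s.E C P' →
      IdealSheafData.IsPermissible C ∧ (C.support : Set s.W) ⊆ Scheme.hsStratum s.W N ν)
    (hpt : s.pt ∈ Scheme.hsStratum s.W N ν) (hptcl : IsClosed ({s.pt} : Set s.W)) (hnot : ¬ Iso N s.toMarkedStage)
    (hnot' : ¬ Iso N s'.toMarkedStage) (hlow : s.toMarkedStage.geomDirDim ≤ 2) (hchar : CharHypothesis s.W s.pt)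
    (hsw : ∀ (C : s.W.IdealSheafData) (P' : Option (Pending (blowup C))), σ.step s.W s.ln N ν s.L s.P s.E C P' →
      s.pt ∈ (C.support : Set s.W) → ∃ Z ∈ componentsThrough N ν s.toMarkedStage, Z ⊆ (C.support : Set s.W))
    {Z' : Set s'.W} (hZ' : Z' ∈ componentsThrough N ν s'.toMarkedStage) :
    closure (f.base '' Z') ∈ componentsIn (Scheme.hsStratum s.W N ν) := by
  by_contra hbirth
  have hx'ν : s'.pt ∈ Scheme.hsStratum s'.W N ν := hf.pt_mem_hsStratum
  obtain ⟨C, P', hln, x', hcs, hπ, -, hx', e, rfl⟩ := hf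
  subst e
  simp only [eqToHom_refl, Category.id_comp] at hbirth ⊢
  haveI : IsLocallyNoetherian s.W := s.ln
  haveI : IsLocallyNoetherian (blowup C) := hln
  haveI : IsNoetherian s.W := by
    obtain ⟨g, hg, hq⟩ := hgood.overField
    exact Scheme.isNoetherian_of_finiteType_over_field g
  haveI : IsNoetherian (blowup C) := by
    obtain ⟨g, hg, hq⟩ := hgood'.overField
    exact Scheme.isNoetherian_of_finiteType_over_field g
  obtain ⟨hperm, hCsub⟩ := hadm C P' hcs
  have hCreg : Literature.AlgebraicGeometry.Resolution.Scheme.IsRegular C.subscheme := isRegular_subscheme_of_isPermissible hperm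
  have hexc : Scheme.IsExcellent s.W := hgood.isExcellent
  have hY : IsClosed (Scheme.hsStratum s.W N ν) := hgood.isClosed_hsStratum
  have hY' : IsClosed (Scheme.hsStratum (blowup C) N ν) := hgood'.isClosed_hsStratum
  have hπY' : (blowup.π C).base '' Scheme.hsStratum (blowup C) N ν ⊆ Scheme.hsStratum s.W N ν := by
    rintro _ ⟨z, hz, rfl⟩
    have hle := (blowup.isBlowup C).hsFun_le_of_isPermissible hexc hperm N z
    exact hgood.supMax _ ((Scheme.mem_hsStratum_iff.mp hz).symm.le.trans hle)
  have hST : ∀ T, T ⊆ Scheme.hsStratum s.W N ν →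
      strictTransformSet (blowup.π C) (C.support : Set s.W) T ⊆ Scheme.hsStratum (blowup C) N ν :=
    fun T hT => strictTransformSet_subset_hsStratum C hT hY'
  -- births lie over the centre, so the chain point lies in the centre
  have hZ'sub : Z' ⊆ (blowup.π C).base ⁻¹' (C.support : Set s.W) :=
    subset_preimage_support_of_not_mem_componentsIn C hY (componentsIn.finite _) hY' (componentsIn.finite _) hπY' hST hZ'.1 hbirth
  have hmem : s.pt ∈ (C.support : Set s.W) := by
    have h := hZ'sub hZ'.2
    rw [Set.mem_preimage] at h
    change (blowup.π C).base x' ∈ _ at h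
    rwa [hπ] at h
  -- the swallowed component and a generisation of the chain point inside the centre
  obtain ⟨Z, hZT, hZC⟩ := hsw C P' hcs hmem
  have hZnt : Z.Nontrivial := nontrivial_of_mem_componentsThrough_of_not_iso hgood hpt hnot hZT
  have hZirr : IsIrreducible Z := componentsIn.isIrreducible hZT.1
  have hZcl : IsClosed Z := componentsIn.isClosed hY hZT.1
  have hZgen : IsGenericPoint hZirr.genericPoint Z := hZirr.isGenericPoint_genericPoint hZcl
  have hηx : hZirr.genericPoint ⤳ s.pt := hZgen.specializes hZT.2
  have hηne : hZirr.genericPoint ≠ s.pt := by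
    intro h
    obtain ⟨a, ha, b, hb, hab⟩ := hZnt
    have hZs : Z = {s.pt} := by rw [← hZgen.def, h, hptcl.closure_eq]
    rw [hZs] at ha hb
    exact hab (ha.trans hb.symm)
  have h1 : (1 : WithBot ℕ∞) ≤ ringKrullDim (s.W.presheaf.stalk s.pt ⧸ stalkIdeal C s.pt) :=
    one_le_ringKrullDim_quotient_stalkIdeal C hηx hηne (hZC hZgen.mem)
  -- `e ≤ ē ≤ 2`
  have he2 : (Scheme.dirDim s.W s.pt : WithBot ℕ∞) ≤ 2 := by
    have h : Scheme.dirDim s.W s.pt ≤ 2 := (Scheme.dirDim_le_geomDirDim s.pt).trans hlow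
    exact_mod_cast h
  -- F-61: the near fibre over the chain point is a subsingleton
  have hfib : {z : ↥(blowup C) | (blowup.π C).base z = s.pt ∧
      Scheme.hsFun (blowup C) N z = Scheme.hsFun s.W N s.pt}.Subsingleton := by
    refine h314f s.W (blowup C) (blowup.π C) C hexc hperm (blowup.isBlowup C) N hgood.dim_le s.pt hmem hchar ?_
    refine he2.trans ?_
    have h2 : (2 : WithBot ℕ∞) = 1 + 1 := by norm_num
    rw [h2]
    exact add_le_add h1 le_rfl
  -- Thm. 3.14 (numerical) at the near point `x'`: `dim 𝒪_{V(C),x} < e_x ≤ 2`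
  have hlt : ringKrullDim (s.W.presheaf.stalk s.pt ⧸ stalkIdeal C s.pt) < 2 := by
    have key := h314 s.W (blowup C) (blowup.π C) C hexc hperm (blowup.isBlowup C) N hgood.dim_le x' (by rw [hπ]; exact hmem)
      (by rw [hπ]; exact hchar) (by rw [hπ, Scheme.mem_hsStratum_iff.mp hx', Scheme.mem_hsStratum_iff.mp hpt])
    rw [hπ] at key
    exact key.trans_le he2
  -- the generic point of `Z'` and its image
  have hZ'irr : IsIrreducible Z' := componentsIn.isIrreducible hZ'.1
  have hZ'cl : IsClosed Z' := componentsIn.isClosed hY' hZ'.1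
  have hζ : IsGenericPoint hZ'irr.genericPoint Z' := hZ'irr.isGenericPoint_genericPoint hZ'cl
  set ζ := hZ'irr.genericPoint with hζdef
  have hclA : closure ((blowup.π C).base '' Z') = closure {(blowup.π C).base ζ} := by
    conv_lhs => rw [← hζ.def]
    exact closure_image_closure_singleton (blowup.π C).continuous ζ
  by_cases ha : (blowup.π C).base ζ = s.pt
  · -- `Z'` lies in the near fibre over `x`: `Z' = {x'}`, impossible at a never-isolated stage
    have hZ'fib : Z' ⊆ {z : ↥(blowup C) | (blowup.π C).base z = s.pt ∧
        Scheme.hsFun (blowup C) N z = Scheme.hsFun s.W N s.pt} := by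
      intro z hz
      refine ⟨?_, ?_⟩
      · have hz1 : (blowup.π C).base z ∈ closure {(blowup.π C).base ζ} := by
          rw [← hclA]
          exact subset_closure ⟨z, hz, rfl⟩
        rw [ha, hptcl.closure_eq] at hz1
        exact hz1
      · rw [Scheme.mem_hsStratum_iff.mp (componentsIn.subset hZ'.1 hz), Scheme.mem_hsStratum_iff.mp hpt]
    have hx'fib : x' ∈ {z : ↥(blowup C) | (blowup.π C).base z = s.pt ∧
        Scheme.hsFun (blowup C) N z = Scheme.hsFun s.W N s.pt} :=
      ⟨hπ, by rw [Scheme.mem_hsStratum_iff.mp hx', Scheme.mem_hsStratum_iff.mp hpt]⟩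
    have hsub : Z' ⊆ {x'} := fun z hz => hfib (hZ'fib hz) hx'fib
    have hZ'nt : Z'.Nontrivial := nontrivial_of_mem_componentsThrough_of_not_iso hgood' hx'ν hnot' hZ'
    obtain ⟨a, ha', b, hb', hab⟩ := hZ'nt
    exact hab ((hsub ha').trans (hsub hb').symm)
  · -- `A = closure {π ζ}` is an irreducible closed subset of `V(C)` through `x`, not `{x}`: a component of `V(C)`, hence `= Z`
    have hAsub : closure {(blowup.π C).base ζ} ⊆ (C.support : Set s.W) :=
      closure_minimal (Set.singleton_subset_iff.mpr (hZ'sub hζ.mem)) C.support.isClosed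
    have hAirr : IsIrreducible (closure {(blowup.π C).base ζ}) := isIrreducible_singleton.closure
    have hxA : s.pt ∈ closure {(blowup.π C).base ζ} := by
      rw [← hclA]
      exact subset_closure ⟨x', hZ'.2, hπ⟩
    -- `A` is a component of `V(C)`
    have hAcomp : closure {(blowup.π C).base ζ} ∈ componentsIn (C.support : Set s.W) := by
      by_contra hnotA
      obtain ⟨D₀, hD₀, hAD⟩ := exists_componentsIn_superset C.support.isClosed (componentsIn.finite _) hAirr hAsub
      have hAD' : closure {(blowup.π C).base ζ} ≠ D₀ := fun h => hnotA (h ▸ hD₀)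
      have hD₀irr : IsIrreducible D₀ := componentsIn.isIrreducible hD₀
      have hD₀cl : IsClosed D₀ := componentsIn.isClosed C.support.isClosed hD₀
      have hAgen : IsGenericPoint hAirr.genericPoint (closure {(blowup.π C).base ζ}) :=
        hAirr.isGenericPoint_genericPoint isClosed_closure
      have hDgen : IsGenericPoint hD₀irr.genericPoint D₀ := hD₀irr.isGenericPoint_genericPoint hD₀cl
      have hax : hAirr.genericPoint ⤳ s.pt := hAgen.specializes hxA
      have hηa : hD₀irr.genericPoint ⤳ hAirr.genericPoint := hDgen.specializes (hAD hAgen.mem)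
      have hne₁ : hAirr.genericPoint ≠ s.pt := by
        intro h
        apply ha
        have : (blowup.π C).base ζ ∈ ({s.pt} : Set s.W) := by
          rw [← hptcl.closure_eq, ← h, hAgen.def]
          exact subset_closure (Set.mem_singleton _)
        exact this
      have hne₂ : hD₀irr.genericPoint ≠ hAirr.genericPoint := by
        intro h
        apply hAD'
        rw [← hAgen.def, ← hDgen.def, h]
      have h2 := two_le_ringKrullDim_quotient_stalkIdeal C hax hηa hne₁ hne₂ ((componentsIn.subset hD₀) hDgen.mem)
        (hAsub hAgen.mem)
      exact absurd (h2.trans_lt hlt) (lt_irrefl _)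
    -- `Z` is a component of `V(C)` as well
    have hZcomp : Z ∈ componentsIn (C.support : Set s.W) := by
      obtain ⟨D₁, hD₁, hZD⟩ := exists_componentsIn_superset C.support.isClosed (componentsIn.finite _) hZirr hZC
      have hD₁Z : D₁ ⊆ Z := (mem_componentsIn_iff.mp hZT.1).2.2 D₁ ((componentsIn.subset hD₁).trans hCsub)
        (componentsIn.isIrreducible hD₁) hZD
      have : Z = D₁ := Set.Subset.antisymm hZD hD₁Z
      rw [this]
      exact hD₁
    have hAZ : closure {(blowup.π C).base ζ} = Z := eq_of_mem_componentsIn_of_isRegular hCreg hAcomp hZcomp hxA hZT.2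
    apply hbirth
    rw [hclA, hAZ]
    exact hZT.1

/-! ## §2. (c-swallow)From ⇒ (b)From at W-low -/

/-- **THE (b) SUPPLIER — PROVED: on the From-`s₀` scope of the Low adapter, for a grade `G ⊆ (ē ≤ 2)` and `CharHypothesis` along the reach,
`StrataSwallowFromσE σ N ν s₀ G → StrataBirthsSettleFromσE σ N ν s₀ G`** (any boundary-reading `σ` whose steps at reached states have permissible in-stratum
centres; good stages; closed marked point of `s₀` in the stratum), modulo CJS Thm. 3.14 (numerical + near-fibre forms). [cite: CossartJannsenSaito2020, Thm. 3.14, Rem. 6.29 (1)] -/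
theorem strataBirthsSettleFromσE_of_swallow (h314 : CossartJannsenSaito2020_thm_3_14.{u}) (h314f : Thm314_nearFibre_subsingleton.{u})
    {s₀ : MarkedStageE.{u}} {G : MarkedStage.{u} → Prop} (hG : ∀ s, G s → s.geomDirDim ≤ 2)
    (hgood : ∀ s, ReachesσE σ N ν s₀ s → RunGood k N ν s.W)
    (hadm : ∀ s, ReachesσE σ N ν s₀ s → ∀ (C : s.W.IdealSheafData) (P' : Option (Pending (blowup C))),
      σ.step s.W s.ln N ν s.L s.P s.E C P' → IdealSheafData.IsPermissible C ∧ (C.support : Set s.W) ⊆ Scheme.hsStratum s.W N ν)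
    (hchar : ∀ s, ReachesσE σ N ν s₀ s → CharHypothesis s.W s.pt)
    (hpt₀ : s₀.pt ∈ Scheme.hsStratum s₀.W N ν) (hptcl₀ : IsClosed ({s₀.pt} : Set s₀.W))
    (hswallow : StrataSwallowFromσE σ N ν s₀ G) : StrataBirthsSettleFromσE σ N ν s₀ G := by
  intro c h0 hstep hGc hnI hmov
  obtain ⟨n₂, hn₂⟩ := hswallow c h0 hstep hGc hnI hmov
  have hreach : ∀ n, ReachesσE σ N ν s₀ (c n) := reachesσE_chain h0 hstep
  refine ⟨n₂, fun n hn f hf Z' hZ' => ?_⟩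
  exact hf.closure_image_mem_componentsIn_of_swallow h314 h314f (hgood _ (hreach n)) (hgood _ (hreach (n + 1))) (hadm _ (hreach n))
    (pt_mem_hsStratum_of_reachesσE (hreach n) hpt₀) ((hreach n).isClosed_pt hptcl₀) (hnI n) (hnI (n + 1)) (hG _ (hGc n))
    (hchar _ (hreach n)) (fun C P' hcs hx => hn₂ n hn C P' hcs hx) hZ'

/-! ## §3. `CharHypothesis` along runs in the regime `3 ≤ p`, and the origin-level forms -/

/-- **`CharHypothesis` at every state reached from a maximal origin of dimension `≤ 3` over a field of characteristic `p ≥ 3`** (the (F1) regime of the char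
row: residue characteristic `p` along the run, `dim ≤ 3`, `d + 2 ≤ 5 ≤ 6 ≤ 2p`). [cite: CossartJannsenSaito2020, Thm. 10.2] -/
theorem charHypothesis_of_reachesσE {p : ℕ} [CharP k p] (hp : 3 ≤ p) {s₀ s : MarkedStageE.{u}} (hr : ReachesσE σ N ν s₀ s)
    (hdim₀ : topologicalKrullDim s₀.W ≤ ((3 : ℕ) : WithBot ℕ∞)) (hgood : RunGood k N ν s.W) : CharHypothesis s.W s.pt := by
  obtain ⟨g, -, -⟩ := hgood.overField
  have hchar : ringChar (ResidueField (s.W.presheaf.stalk s.pt)) = p := ringChar_residueField_eq g s.pt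
  obtain ⟨d, hd, hd3⟩ := exists_topologicalKrullDim_eq s.pt (dim_le_of_reachesσE hr hdim₀)
  refine ⟨d, hd, Or.inr ?_⟩
  rw [hchar]
  omega

/-- **THE (b) SUPPLIER AT A MAXIMAL ORIGIN, regime `3 ≤ p`** (σ admissible on its run-wise scope; grade `ē < 3`): (c-swallow)From ⇒ (b)From at
`MarkedStageE.init X x (E₀ X x)`, modulo CJS Thm. 3.14 (numerical + near-fibre forms). [cite: CossartJannsenSaito2020, Thm. 3.14, Thm. 3.10 (1)] -/
theorem strataBirthsSettleFromσE_init_of_swallow (h314 : CossartJannsenSaito2020_thm_3_14.{u}) (h314f : Thm314_nearFibre_subsingleton.{u})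
    {p : ℕ} (hp : 3 ≤ p) {E₀ : ∀ (X : Scheme.{u}), X → Boundary X}
    (hadm : IsAdmissibleStrategyOnE (StrategyE.RunReachableState p σ 3 ν E₀) 3 ν σ)
    {X : Scheme.{u}} [IsLocallyNoetherian X] {x : X} (hX : IsMaximalOrigin p 3 ν X x)
    (hswallow : StrataSwallowFromσE σ 3 ν (MarkedStageE.init X x (E₀ X x)) fun s => s.geomDirDim < 3) :
    StrataBirthsSettleFromσE σ 3 ν (MarkedStageE.init X x (E₀ X x)) fun s => s.geomDirDim < 3 := by
  obtain ⟨k', hk', hchp, g, -, hft, hqc⟩ := hX.exists_structure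
  have h0 : RunGood k' 3 ν X := ⟨⟨g, hft, hqc⟩, hX.isReduced, hX.dim_le, fun w hw => le_antisymm (hX.maximal.2 ⟨w, rfl⟩ hw) hw⟩
  have hperm : ∀ (W : Scheme.{u}) (hW : IsLocallyNoetherian W) (L : Labelling W) (P : Option (Pending W)) (E : Boundary W),
      StrategyE.RunReachableState p σ 3 ν E₀ W hW L P E →
        ∀ (C : W.IdealSheafData) (P' : Option (Pending (blowup C))), σ.step W hW 3 ν L P E C P' → IdealSheafData.IsPermissible C :=
    fun W hW L P E hS C P' hst => ((hadm W hW L P E hS).1 C P' hst).1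
  have hscope : ∀ s : MarkedStageE.{u}, ReachesσE σ 3 ν (MarkedStageE.init X x (E₀ X x)) s →
      StrategyE.RunReachableState p σ 3 ν E₀ s.W s.ln s.L s.P s.E := fun s hs =>
    StrategyE.reachableState_subset_runReachableState (StrategyE.reachableState_of_inScopeMσE ⟨X, inferInstance, x, hX, hs⟩)
  have hgood : ∀ s : MarkedStageE.{u}, ReachesσE σ 3 ν (MarkedStageE.init X x (E₀ X x)) s → RunGood k' 3 ν s.W := fun s hs =>
    runGood_of_stateReachesσE (t := s.toStateσE) hX h0 hperm hs.stateReachesσE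
  refine strataBirthsSettleFromσE_of_swallow (k := k') h314 h314f (fun s (hs : s.geomDirDim < 3) => by omega) hgood
    (fun s hs C P' hst => ?_) (fun s hs => charHypothesis_of_reachesσE hp hs hX.dim_le (hgood s hs)) hX.mem_stratum hX.isClosed hswallow
  obtain ⟨h1, h2, -⟩ := (hadm s.W s.ln s.L s.P s.E (hscope s hs)).1 C P' hst
  exact ⟨h1, h2⟩

/-- **E7's LOW CLASS AT A MAXIMAL ORIGIN FOR THE MENU HYBRID, regime `3 ≤ p`, from (c-rep), (c-menu) and the units half ONLY** ((b) supplied by §3,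
(c-swallow) by `…HybridLowSwallow`), modulo the kill row and CJS Thm. 3.14 (numerical + near-fibre forms). [cite: CossartJannsenSaito2020, Thm. 3.14, Thm. 6.35, Thm. 6.40, p. 107] -/
theorem low_init_hybrid_of_rows_of_swallow {π : StrategyE.{u}} {ω : StageOracleE.{u}} (hK : LocalNearPointChainsTerminate.{u})
    (h314 : CossartJannsenSaito2020_thm_3_14.{u}) (h314f : Thm314_nearFibre_subsingleton.{u}) {p : ℕ} (hp : 3 ≤ p)
    (hπ : π.IsFunctional 3 ν) (hω : OracleFunctionalΩE ω) {E₀ : ∀ (X : Scheme.{u}), X → Boundary X}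
    (hadm : IsAdmissibleStrategyOnE (StrategyE.RunReachableState p (π.hybrid (StrategyE.ofStageOracleE ω)) 3 ν E₀) 3 ν
      (π.hybrid (StrategyE.ofStageOracleE ω)))
    {X : Scheme.{u}} [IsLocallyNoetherian X] {x : X} (hX : IsMaximalOrigin p 3 ν X x)
    (hrep : StrataReplaySettleFromσE (π.hybrid (StrategyE.ofStageOracleE ω)) 3 ν (MarkedStageE.init X x (E₀ X x))
      fun s => s.geomDirDim < 3)
    (hmenu : StrataPolicySwallowFromσE π (π.hybrid (StrategyE.ofStageOracleE ω)) 3 ν (MarkedStageE.init X x (E₀ X x))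
      fun s => s.geomDirDim < 3)
    (hunits : NoMovingRecurrentNearChainFromσE (π.hybrid (StrategyE.ofStageOracleE ω)) 3 ν (MarkedStageE.init X x (E₀ X x))
      (fun s => s.geomDirDim < 3) fun s => Iso 3 s) :
    ∀ e, e < 3 → NoMovingNearChainFromσE (π.hybrid (StrategyE.ofStageOracleE ω)) 3 ν (MarkedStageE.init X x (E₀ X x))
      fun s => s.geomDirDim = e := by
  have hsw := strataSwallowFromσE_hybrid_of_replaySettle_menuSwallow hπ hω hrep hmenu
  exact low_init_of_births_swallow_units hK (by norm_num) le_rfl (hπ.hybrid (StrategyE.isFunctional_ofStageOracleE hω 3 ν)) hadm hX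
    (strataBirthsSettleFromσE_init_of_swallow h314 h314f hp hadm hX hsw) hsw hunits

end Summit.ResolutionOfSingularities.ResolutionOfSingularities.Theorems.SigmaMaxModificationsCorridor3.Sigma

end
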